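import Summits.CriticalPhenomena.PercolationContinuityZ3.Theorems.PercNearOneGluingNoHeavyLowerTailAPLVwThreeLoadPerc
import Summits.CriticalPhenomena.PercolationContinuityZ3.Theorems.PercNearOneGluingNoHeavyLowerTailAPLTreeFourPointVariance
import HarnessLib

/-!
# `NoHeavyLowerTail` (stmt-CriticalPhenomena-4575) — (V) `Var(L)² ≤ 2E[L]|Cov(L,R)|` and (Q0) `2κ₃(L) + 3Var(L)²/E L + 12Cov(L,R) ≤ 0`
# for loads on three vertices, as inequalities between MOMENTS of bond percolation on every finite weighted graph

Support file (prover prim-ineq-gen-8 gen 52; `--supports stmt-CriticalPhenomena-4575`; memo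
run/shared/lean/prim/prim-ineq-gen-8/FINDING-gen52-THREELOAD-LEAN.md §3).  No definitions, no named facts, no sorries.

`μ = prodBernoulli w` on the pairs of a finite vertex type `V` (arbitrary edge weights), apex `s`, loads `ℓ : V → ℝ`, `ℓ ≥ 0`,
SUPPORTED ON THREE DISTINCT VERTICES `a, b, c`; `L = Σ_u ℓ_u 1[s↔u]` (the load of the cluster `K = C(s)`), `S₂ = Σ_{v,x} ℓ_vℓ_x 1[v↔x]`
(`= Σ_C ℓ(C)²` over the open clusters), `R = S₂ − L²` (the squared loads of the clusters other than `K`) — the random variables of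
`APL.cov_load_S2_le` / `APL.kappa3_add_three_cov_nonpos` ((P), gens 39–40).
THIS FILE turns the expanded-form theorems `threeLoad_vw` / `threeLoad_v` (`…APLVwThreeLoadPerc.lean`) into statements about the
moments `E L`, `E L²`, `E L³`, `E S₂`, `E[L·S₂]` [this work]:
* bookkeeping: `integral_load_sq` (`E L² = Σ_{u,v}ℓ_uℓ_v μ(s↔u,s↔v)`), `sum_support3` (support reduction),
  `openConn_su_inter_ux/xu`, `inter_inter_self_left`, and the five moment identities `threeLoad_moment1/2/3`, `threeLoad_momentS2`,
  `threeLoad_momentLS2` (e.g. `E[L·S₂] = (Σℓ_v²)(Σℓ_up_u) + 2Σ_{u<v}ℓ_uℓ_v(ℓ_u+ℓ_v)τ_uv + 2ℓ_aℓ_bℓ_c(3τ_abc + χ_a + χ_b + χ_c)`, using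
  `real_conn_inter_conn_split`); the `τ_abc` terms cancel in `Cov(L,R)`;
* **`threeLoad_var_sq_le`** — (V) `(E L² − (E L)²)² ≤ 2·E L·(E L·E R − E[L R])` for every load on three vertices with
  `0 < μ(s↔v) < 1`, on every finite weighted graph;
* **`threeLoad_Q0`** — (Q0) `2κ₃(L) + 3Var(L)²/E L + 12Cov(L,R) ≤ 0` (`κ₃ = E L³ − 3E L E L² + 2(E L)³`) from (V) and the kernel
  theorem (P) `κ₃(L) + 3Cov(L,R) ≤ 0` (`cov_load_S2_le`): gen 39's `E3(θ) ≤ 0` for every load direction supported on at most three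
  vertices (memo FINDING-gen39-TE-CORES.md; two vertices: `twoLoad_vw`), now a theorem on every finite weighted graph.
-/

noncomputable section

namespace Summit.CriticalPhenomena.PercolationContinuityZ3.Theorems

namespace APL

open MeasureTheory Set Literature.Probability.Percolation Literature.Probability.LatticeModels
open scoped Classical

variable {V : Type*} [Fintype V] (w : Sym2 V → unitInterval) (s : V)

/-- `E[L²] = Σ_{u,v} ℓ_u ℓ_v P(s↔u, s↔v)`. [folklore] -/
theorem integral_load_sq (ℓ : V → ℝ) :
    ∫ ω, (∑ u, ℓ u * (openConn s u : Set (BondConfig V)).indicator 1 ω) ^ 2 ∂(prodBernoulli w) =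
      ∑ u, ∑ v, ℓ u * ℓ v * (prodBernoulli w).real (openConn s u ∩ openConn s v : Set (BondConfig V)) := by
  have hpt : ∀ ω : BondConfig V, (∑ u, ℓ u * (openConn s u : Set (BondConfig V)).indicator 1 ω) ^ 2 =
      ∑ u, ∑ v, ℓ u * ℓ v * (openConn s u ∩ openConn s v : Set (BondConfig V)).indicator 1 ω := by
    intro ω
    rw [sq, Finset.sum_mul_sum]
    refine Finset.sum_congr rfl fun u _ => Finset.sum_congr rfl fun v _ => ?_
    rw [← indicator_one_mul_indicator_one]; ring
  rw [integral_congr_ae (ae_of_all _ hpt)]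
  rw [integral_finsetSum _ (fun u _ => Integrable.of_finite)]
  refine Finset.sum_congr rfl fun u _ => ?_
  rw [integral_finsetSum _ (fun v _ => Integrable.of_finite)]
  refine Finset.sum_congr rfl fun v _ => ?_
  rw [integral_const_mul, integral_indicator_one MeasurableSet.of_discrete]

/-- Support reduction: if `ℓ` vanishes off three distinct vertices `a, b, c`, then `Σ_u ℓ_u f(u) = ℓ_a f(a) + ℓ_b f(b) + ℓ_c f(c)`.
[folklore] -/
theorem sum_support3 (ℓ : V → ℝ) {a b c : V} (hab : a ≠ b) (hac : a ≠ c) (hbc : b ≠ c)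
    (hsupp : ∀ u, u ≠ a → u ≠ b → u ≠ c → ℓ u = 0) (f : V → ℝ) :
    ∑ u, ℓ u * f u = ℓ a * f a + ℓ b * f b + ℓ c * f c := by
  have h : ∑ u, ℓ u * f u = ∑ u ∈ ({a, b, c} : Finset V), ℓ u * f u := by
    refine (Finset.sum_subset (Finset.subset_univ _) fun u _ hu => ?_).symm
    simp only [Finset.mem_insert, Finset.mem_singleton, not_or] at hu
    rw [hsupp u hu.1 hu.2.1 hu.2.2, zero_mul]
  rw [h, Finset.sum_insert (by simp [hab, hac]), Finset.sum_insert (by simp [hbc]), Finset.sum_singleton, add_assoc]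

variable (a b c : V) (ℓ : V → ℝ)

/-- Moment `E[L²]` for a load supported on `{a,b,c}`. [folklore] -/
theorem threeLoad_moment2 (hab : a ≠ b) (hac : a ≠ c) (hbc : b ≠ c)
    (hsupp : ∀ u, u ≠ a → u ≠ b → u ≠ c → ℓ u = 0) :
    ∫ ω, (∑ u, ℓ u * (openConn s u : Set (BondConfig V)).indicator 1 ω) ^ 2 ∂(prodBernoulli w) =
      ℓ a ^ 2 * (prodBernoulli w).real (openConn s a : Set (BondConfig V))
        + ℓ b ^ 2 * (prodBernoulli w).real (openConn s b : Set (BondConfig V))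
        + ℓ c ^ 2 * (prodBernoulli w).real (openConn s c : Set (BondConfig V))
        + 2 * (ℓ a * ℓ b * (prodBernoulli w).real ((openConn s a : Set (BondConfig V)) ∩ (openConn s b : Set (BondConfig V)))
          + ℓ a * ℓ c * (prodBernoulli w).real ((openConn s a : Set (BondConfig V)) ∩ (openConn s c : Set (BondConfig V)))
          + ℓ b * ℓ c * (prodBernoulli w).real ((openConn s b : Set (BondConfig V)) ∩ (openConn s c : Set (BondConfig V)))) := by
  rw [integral_load_sq]
  have hred := sum_support3 ℓ hab hac hbc hsupp
  simp only [mul_assoc]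
  simp only [← Finset.mul_sum]
  simp only [hred]
  -- normalise the intersections
  simp only [Set.inter_self, Set.inter_comm (openConn s b : Set (BondConfig V)) (openConn s a : Set (BondConfig V)),
    Set.inter_comm (openConn s c : Set (BondConfig V)) (openConn s a : Set (BondConfig V)),
    Set.inter_comm (openConn s c : Set (BondConfig V)) (openConn s b : Set (BondConfig V))]
  ring


omit [Fintype V] in
/-- `{s↔u} ∩ {u↔x} = {s↔u} ∩ {s↔x}`. [folklore] -/
theorem openConn_su_inter_ux (u x : V) :
    (openConn s u : Set (BondConfig V)) ∩ (openConn u x : Set (BondConfig V)) =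
      (openConn s u : Set (BondConfig V)) ∩ (openConn s x : Set (BondConfig V)) := by
  rw [Set.inter_comm (openConn s u : Set (BondConfig V)) (openConn u x : Set (BondConfig V)), openConn_vx_inter_sv s u x]

omit [Fintype V] in
/-- `{s↔u} ∩ {x↔u} = {s↔u} ∩ {s↔x}`. [folklore] -/
theorem openConn_su_inter_xu (u x : V) :
    (openConn s u : Set (BondConfig V)) ∩ (openConn x u : Set (BondConfig V)) =
      (openConn s u : Set (BondConfig V)) ∩ (openConn s x : Set (BondConfig V)) := by
  rw [KNPreFKG.openConn_symm x u, openConn_su_inter_ux]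

omit [Fintype V] in
/-- `A ∩ (A ∩ B) = A ∩ B`. [folklore] -/
theorem inter_inter_self_left (A B : Set (BondConfig V)) : A ∩ (A ∩ B) = A ∩ B := by
  rw [← Set.inter_assoc, Set.inter_self]

/-- Moment `E[L]` for a load supported on `{a,b,c}`. [folklore] -/
theorem threeLoad_moment1 (hab : a ≠ b) (hac : a ≠ c) (hbc : b ≠ c)
    (hsupp : ∀ u, u ≠ a → u ≠ b → u ≠ c → ℓ u = 0) :
    ∫ ω, (∑ u, ℓ u * (openConn s u : Set (BondConfig V)).indicator 1 ω) ∂(prodBernoulli w) =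
      ℓ a * (prodBernoulli w).real (openConn s a : Set (BondConfig V))
        + ℓ b * (prodBernoulli w).real (openConn s b : Set (BondConfig V))
        + ℓ c * (prodBernoulli w).real (openConn s c : Set (BondConfig V)) := by
  rw [integral_load, sum_support3 ℓ hab hac hbc hsupp]

/-- Moment `E[L³]` for a load supported on `{a,b,c}`. [folklore] -/
theorem threeLoad_moment3 (hab : a ≠ b) (hac : a ≠ c) (hbc : b ≠ c)
    (hsupp : ∀ u, u ≠ a → u ≠ b → u ≠ c → ℓ u = 0) :
    ∫ ω, (∑ u, ℓ u * (openConn s u : Set (BondConfig V)).indicator 1 ω) ^ 3 ∂(prodBernoulli w) =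
      ℓ a ^ 3 * (prodBernoulli w).real (openConn s a : Set (BondConfig V))
        + ℓ b ^ 3 * (prodBernoulli w).real (openConn s b : Set (BondConfig V))
        + ℓ c ^ 3 * (prodBernoulli w).real (openConn s c : Set (BondConfig V))
        + 3 * (ℓ a ^ 2 * ℓ b + ℓ a * ℓ b ^ 2) *
            (prodBernoulli w).real ((openConn s a : Set (BondConfig V)) ∩ (openConn s b : Set (BondConfig V)))
        + 3 * (ℓ a ^ 2 * ℓ c + ℓ a * ℓ c ^ 2) *
            (prodBernoulli w).real ((openConn s a : Set (BondConfig V)) ∩ (openConn s c : Set (BondConfig V)))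
        + 3 * (ℓ b ^ 2 * ℓ c + ℓ b * ℓ c ^ 2) *
            (prodBernoulli w).real ((openConn s b : Set (BondConfig V)) ∩ (openConn s c : Set (BondConfig V)))
        + 6 * (ℓ a * ℓ b * ℓ c) *
            (prodBernoulli w).real ((openConn s a : Set (BondConfig V)) ∩ (openConn s b : Set (BondConfig V))
              ∩ (openConn s c : Set (BondConfig V))) := by
  rw [integral_load_cube]
  have hred := sum_support3 ℓ hab hac hbc hsupp
  simp only [mul_assoc]
  simp only [← Finset.mul_sum]
  simp only [hred]
  simp only [Set.inter_assoc, Set.inter_self, inter_inter_self_left, Set.inter_comm, Set.inter_left_comm]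
  ring

/-- Moment `E[S₂]` for a load supported on `{a,b,c}` (`S₂ = Σ_{v,x} ℓ_vℓ_x 1[v↔x] = Σ_K ℓ(K)²`). [folklore] -/
theorem threeLoad_momentS2 (hab : a ≠ b) (hac : a ≠ c) (hbc : b ≠ c)
    (hsupp : ∀ u, u ≠ a → u ≠ b → u ≠ c → ℓ u = 0) :
    ∫ ω, (∑ v, ∑ x, ℓ v * ℓ x * (openConn v x : Set (BondConfig V)).indicator 1 ω) ∂(prodBernoulli w) =
      ℓ a ^ 2 + ℓ b ^ 2 + ℓ c ^ 2
        + 2 * (ℓ a * ℓ b * (prodBernoulli w).real (openConn a b : Set (BondConfig V))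
          + ℓ a * ℓ c * (prodBernoulli w).real (openConn a c : Set (BondConfig V))
          + ℓ b * ℓ c * (prodBernoulli w).real (openConn b c : Set (BondConfig V))) := by
  rw [integral_S2]
  have hred := sum_support3 ℓ hab hac hbc hsupp
  simp only [mul_assoc]
  simp only [← Finset.mul_sum]
  simp only [hred]
  rw [KNPreFKG.openConn_symm b a, KNPreFKG.openConn_symm c a, KNPreFKG.openConn_symm c b]
  have hself : ∀ u : V, (openConn u u : Set (BondConfig V)) = Set.univ := fun u =>
    Set.eq_univ_of_forall fun _ => SimpleGraph.Reachable.refl _   -- `IncStarIrreducible.openConn_self`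
  simp only [hself, probReal_univ]
  ring

/-- Moment `E[L·S₂]` for a load supported on `{a,b,c}`. [folklore] -/
theorem threeLoad_momentLS2 (hab : a ≠ b) (hac : a ≠ c) (hbc : b ≠ c)
    (hsupp : ∀ u, u ≠ a → u ≠ b → u ≠ c → ℓ u = 0) :
    ∫ ω, (∑ u, ℓ u * (openConn s u : Set (BondConfig V)).indicator 1 ω)
        * (∑ v, ∑ x, ℓ v * ℓ x * (openConn v x : Set (BondConfig V)).indicator 1 ω) ∂(prodBernoulli w) =
      (ℓ a ^ 2 + ℓ b ^ 2 + ℓ c ^ 2) *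
          (ℓ a * (prodBernoulli w).real (openConn s a : Set (BondConfig V))
            + ℓ b * (prodBernoulli w).real (openConn s b : Set (BondConfig V))
            + ℓ c * (prodBernoulli w).real (openConn s c : Set (BondConfig V)))
        + 2 * (ℓ a * ℓ b * (ℓ a + ℓ b) *
              (prodBernoulli w).real ((openConn s a : Set (BondConfig V)) ∩ (openConn s b : Set (BondConfig V)))
            + ℓ a * ℓ c * (ℓ a + ℓ c) *
              (prodBernoulli w).real ((openConn s a : Set (BondConfig V)) ∩ (openConn s c : Set (BondConfig V)))
            + ℓ b * ℓ c * (ℓ b + ℓ c) *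
              (prodBernoulli w).real ((openConn s b : Set (BondConfig V)) ∩ (openConn s c : Set (BondConfig V))))
        + 2 * (ℓ a * ℓ b * ℓ c) *
          (3 * (prodBernoulli w).real ((openConn s a : Set (BondConfig V)) ∩ (openConn s b : Set (BondConfig V))
              ∩ (openConn s c : Set (BondConfig V)))
            + (prodBernoulli w).real ((openConn s a : Set (BondConfig V)) ∩ (openConn b c : Set (BondConfig V))
              ∩ (openConn s b : Set (BondConfig V))ᶜ)
            + (prodBernoulli w).real ((openConn s b : Set (BondConfig V)) ∩ (openConn a c : Set (BondConfig V))
              ∩ (openConn s a : Set (BondConfig V))ᶜ)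
            + (prodBernoulli w).real ((openConn s c : Set (BondConfig V)) ∩ (openConn a b : Set (BondConfig V))
              ∩ (openConn s a : Set (BondConfig V))ᶜ)) := by
  rw [integral_load_mul_S2]
  have hred := sum_support3 ℓ hab hac hbc hsupp
  simp only [mul_assoc]
  simp only [← Finset.mul_sum]
  simp only [hred]
  rw [KNPreFKG.openConn_symm b a, KNPreFKG.openConn_symm c a, KNPreFKG.openConn_symm c b]
  have hself : ∀ u : V, (openConn u u : Set (BondConfig V)) = Set.univ := fun u =>
    Set.eq_univ_of_forall fun _ => SimpleGraph.Reachable.refl _   -- `IncStarIrreducible.openConn_self`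
  simp only [hself, Set.inter_univ]
  rw [openConn_su_inter_ux s a b, openConn_su_inter_ux s a c, openConn_su_inter_ux s b c,
    openConn_su_inter_xu s b a, openConn_su_inter_xu s c a, openConn_su_inter_xu s c b]
  rw [real_conn_inter_conn_split w s a b c, real_conn_inter_conn_split w s b a c, real_conn_inter_conn_split w s c a b]
  rw [Set.inter_right_comm (openConn s a : Set (BondConfig V)) ((openConn s b : Set (BondConfig V))ᶜ),
    Set.inter_right_comm (openConn s b : Set (BondConfig V)) ((openConn s a : Set (BondConfig V))ᶜ),
    Set.inter_right_comm (openConn s c : Set (BondConfig V)) ((openConn s a : Set (BondConfig V))ᶜ)]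
  simp only [Set.inter_assoc, Set.inter_comm, Set.inter_left_comm]
  ring


/-- **(V) for loads on three vertices, as an inequality between moments of the percolation measure.**  `μ = prodBernoulli w`,
apex `s`, loads `ℓ ≥ 0` supported on three distinct vertices `a, b, c` with `0 < μ(s↔v) < 1` (`v = a,b,c`); `L = Σ_u ℓ_u 1[s↔u]`
(the load of the cluster `K` of `s`), `S₂ = Σ_{v,x} ℓ_vℓ_x 1[v↔x]` (`= Σ_C ℓ(C)²` over the open clusters), `R = S₂ − L²` (the squared
loads of the clusters other than `K`).  Then **`Var(L)² ≤ 2·E[L]·|Cov(L,R)|`**, precisely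
`(E L² − (E L)²)² ≤ 2·E L·(E L·E R − E[L·R])` (and `Cov(L,R) ≤ 0`).  This is `threeLoad_v` with the bookkeeping identities
`threeLoad_moment1/2/3/S2/LS2` (`E L = Σℓ_up_u`, `Var L = Σ_uℓ_uN_u`, `−2Cov(L,R) =` the right-hand side of `threeLoad_vw`;
the `μ(s↔a,s↔b,s↔c)` terms cancel). [this work] -/
theorem threeLoad_var_sq_le (hℓ : ∀ u, 0 ≤ ℓ u) (hab : a ≠ b) (hac : a ≠ c) (hbc : b ≠ c)
    (hsupp : ∀ u, u ≠ a → u ≠ b → u ≠ c → ℓ u = 0)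
    (h0a : 0 < (prodBernoulli w).real (openConn s a : Set (BondConfig V)))
    (h1a : (prodBernoulli w).real (openConn s a : Set (BondConfig V)) < 1)
    (h0b : 0 < (prodBernoulli w).real (openConn s b : Set (BondConfig V)))
    (h1b : (prodBernoulli w).real (openConn s b : Set (BondConfig V)) < 1)
    (h0c : 0 < (prodBernoulli w).real (openConn s c : Set (BondConfig V)))
    (h1c : (prodBernoulli w).real (openConn s c : Set (BondConfig V)) < 1) :
    ((∫ ω, (∑ u, ℓ u * (openConn s u : Set (BondConfig V)).indicator 1 ω) ^ 2 ∂(prodBernoulli w))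
        - (∫ ω, ∑ u, ℓ u * (openConn s u : Set (BondConfig V)).indicator 1 ω ∂(prodBernoulli w)) ^ 2) ^ 2 ≤
      2 * (∫ ω, ∑ u, ℓ u * (openConn s u : Set (BondConfig V)).indicator 1 ω ∂(prodBernoulli w)) *
        ((∫ ω, ∑ u, ℓ u * (openConn s u : Set (BondConfig V)).indicator 1 ω ∂(prodBernoulli w)) *
            ((∫ ω, ∑ v, ∑ x, ℓ v * ℓ x * (openConn v x : Set (BondConfig V)).indicator 1 ω ∂(prodBernoulli w))
              - (∫ ω, (∑ u, ℓ u * (openConn s u : Set (BondConfig V)).indicator 1 ω) ^ 2 ∂(prodBernoulli w)))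
          - ((∫ ω, (∑ u, ℓ u * (openConn s u : Set (BondConfig V)).indicator 1 ω)
                * (∑ v, ∑ x, ℓ v * ℓ x * (openConn v x : Set (BondConfig V)).indicator 1 ω) ∂(prodBernoulli w))
            - (∫ ω, (∑ u, ℓ u * (openConn s u : Set (BondConfig V)).indicator 1 ω) ^ 3 ∂(prodBernoulli w)))) := by
  rw [threeLoad_moment1 w s a b c ℓ hab hac hbc hsupp, threeLoad_moment2 w s a b c ℓ hab hac hbc hsupp,
    threeLoad_moment3 w s a b c ℓ hab hac hbc hsupp, threeLoad_momentS2 w a b c ℓ hab hac hbc hsupp,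
    threeLoad_momentLS2 w s a b c ℓ hab hac hbc hsupp,
    real_openConn_eq_tau_add_off w s a b, real_openConn_eq_tau_add_off w s a c, real_openConn_eq_tau_add_off w s b c]
  have hv := threeLoad_v w s a b c (ℓ a) (ℓ b) (ℓ c) (hℓ a) (hℓ b) (hℓ c) rfl rfl rfl rfl rfl rfl rfl rfl rfl rfl rfl rfl
    h0a h1a h0b h1b h0c h1c
  set pa := (prodBernoulli w).real (openConn s a : Set (BondConfig V))
  set pb := (prodBernoulli w).real (openConn s b : Set (BondConfig V))
  set pc := (prodBernoulli w).real (openConn s c : Set (BondConfig V))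
  set tab := (prodBernoulli w).real ((openConn s a : Set (BondConfig V)) ∩ (openConn s b : Set (BondConfig V)))
  set tac := (prodBernoulli w).real ((openConn s a : Set (BondConfig V)) ∩ (openConn s c : Set (BondConfig V)))
  set tbc := (prodBernoulli w).real ((openConn s b : Set (BondConfig V)) ∩ (openConn s c : Set (BondConfig V)))
  set tabc := (prodBernoulli w).real ((openConn s a : Set (BondConfig V)) ∩ (openConn s b : Set (BondConfig V))
    ∩ (openConn s c : Set (BondConfig V)))
  set mab := (prodBernoulli w).real ((openConn a b : Set (BondConfig V)) ∩ (openConn s a : Set (BondConfig V))ᶜ)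
  set mac := (prodBernoulli w).real ((openConn a c : Set (BondConfig V)) ∩ (openConn s a : Set (BondConfig V))ᶜ)
  set mbc := (prodBernoulli w).real ((openConn b c : Set (BondConfig V)) ∩ (openConn s b : Set (BondConfig V))ᶜ)
  set ca := (prodBernoulli w).real ((openConn s a : Set (BondConfig V)) ∩ (openConn b c : Set (BondConfig V))
    ∩ (openConn s b : Set (BondConfig V))ᶜ)
  set cb := (prodBernoulli w).real ((openConn s b : Set (BondConfig V)) ∩ (openConn a c : Set (BondConfig V))
    ∩ (openConn s a : Set (BondConfig V))ᶜ)
  set cc := (prodBernoulli w).real ((openConn s c : Set (BondConfig V)) ∩ (openConn a b : Set (BondConfig V))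
    ∩ (openConn s a : Set (BondConfig V))ᶜ)
  clear_value pa pb pc tab tac tbc tabc mab mac mbc ca cb cc
  set x := ℓ a
  set y := ℓ b
  set z := ℓ c
  clear_value x y z
  have e1 : x ^ 2 * pa + y ^ 2 * pb + z ^ 2 * pc + 2 * (x * y * tab + x * z * tac + y * z * tbc) - (x * pa + y * pb + z * pc) ^ 2
      = x * (x * pa * (1 - pa) + y * (tab - pa * pb) + z * (tac - pa * pc))
        + y * (y * pb * (1 - pb) + x * (tab - pa * pb) + z * (tbc - pb * pc))
        + z * (z * pc * (1 - pc) + x * (tac - pa * pc) + y * (tbc - pb * pc)) := by ring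
  rw [e1]
  refine hv.trans (le_of_eq ?_)
  ring

/-- **(Q0) for loads on three vertices**: in the setting of `threeLoad_var_sq_le`, with `κ₃(L) = E L³ − 3E L·E L² + 2(E L)³`
and `Cov(L,R) = E[L·R] − E L·E R`, `R = S₂ − L²`:
  `2κ₃(L) + 3·Var(L)²/E L + 12·Cov(L,R) ≤ 0`
(for `E L > 0`, i.e. some load positive).  From (P) `κ₃(L) + 3Cov(L,R) ≤ 0` (`APL.cov_load_S2_le`, gens 39–40, every finite graph)
and (V) (`threeLoad_var_sq_le`): `2κ₃ + 3Var²/EL + 12Cov ≤ 2(κ₃+3Cov) + (3Var²/EL + 6Cov) ≤ 0`.  This is gen 39's `E3(θ) ≤ 0`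
for every load direction supported on ≤ 3 vertices (memo FINDING-gen39-TE-CORES.md), now on every finite weighted graph. [this work] -/
theorem threeLoad_Q0 (hℓ : ∀ u, 0 ≤ ℓ u) (hab : a ≠ b) (hac : a ≠ c) (hbc : b ≠ c)
    (hsupp : ∀ u, u ≠ a → u ≠ b → u ≠ c → ℓ u = 0) (hpos : 0 < ℓ a + ℓ b + ℓ c)
    (h0a : 0 < (prodBernoulli w).real (openConn s a : Set (BondConfig V)))
    (h1a : (prodBernoulli w).real (openConn s a : Set (BondConfig V)) < 1)
    (h0b : 0 < (prodBernoulli w).real (openConn s b : Set (BondConfig V)))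
    (h1b : (prodBernoulli w).real (openConn s b : Set (BondConfig V)) < 1)
    (h0c : 0 < (prodBernoulli w).real (openConn s c : Set (BondConfig V)))
    (h1c : (prodBernoulli w).real (openConn s c : Set (BondConfig V)) < 1) :
    2 * ((∫ ω, (∑ u, ℓ u * (openConn s u : Set (BondConfig V)).indicator 1 ω) ^ 3 ∂(prodBernoulli w))
          - 3 * (∫ ω, ∑ u, ℓ u * (openConn s u : Set (BondConfig V)).indicator 1 ω ∂(prodBernoulli w))
              * (∫ ω, (∑ u, ℓ u * (openConn s u : Set (BondConfig V)).indicator 1 ω) ^ 2 ∂(prodBernoulli w))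
          + 2 * (∫ ω, ∑ u, ℓ u * (openConn s u : Set (BondConfig V)).indicator 1 ω ∂(prodBernoulli w)) ^ 3)
      + 3 * ((∫ ω, (∑ u, ℓ u * (openConn s u : Set (BondConfig V)).indicator 1 ω) ^ 2 ∂(prodBernoulli w))
          - (∫ ω, ∑ u, ℓ u * (openConn s u : Set (BondConfig V)).indicator 1 ω ∂(prodBernoulli w)) ^ 2) ^ 2
        / (∫ ω, ∑ u, ℓ u * (openConn s u : Set (BondConfig V)).indicator 1 ω ∂(prodBernoulli w))
      + 12 * (((∫ ω, (∑ u, ℓ u * (openConn s u : Set (BondConfig V)).indicator 1 ω)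
                * (∑ v, ∑ x, ℓ v * ℓ x * (openConn v x : Set (BondConfig V)).indicator 1 ω) ∂(prodBernoulli w))
            - (∫ ω, (∑ u, ℓ u * (openConn s u : Set (BondConfig V)).indicator 1 ω) ^ 3 ∂(prodBernoulli w)))
          - (∫ ω, ∑ u, ℓ u * (openConn s u : Set (BondConfig V)).indicator 1 ω ∂(prodBernoulli w))
            * ((∫ ω, ∑ v, ∑ x, ℓ v * ℓ x * (openConn v x : Set (BondConfig V)).indicator 1 ω ∂(prodBernoulli w))
              - (∫ ω, (∑ u, ℓ u * (openConn s u : Set (BondConfig V)).indicator 1 ω) ^ 2 ∂(prodBernoulli w)))) ≤ 0 := by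
  have hP := cov_load_S2_le w s ℓ hℓ
  have hV := threeLoad_var_sq_le w s a b c ℓ hℓ hab hac hbc hsupp h0a h1a h0b h1b h0c h1c
  have hEL : 0 < ∫ ω, ∑ u, ℓ u * (openConn s u : Set (BondConfig V)).indicator 1 ω ∂(prodBernoulli w) := by
    rw [threeLoad_moment1 w s a b c ℓ hab hac hbc hsupp]
    by_contra hle
    push Not at hle
    have t1 : 0 ≤ ℓ a * (prodBernoulli w).real (openConn s a : Set (BondConfig V)) := mul_nonneg (hℓ a) h0a.le
    have t2 : 0 ≤ ℓ b * (prodBernoulli w).real (openConn s b : Set (BondConfig V)) := mul_nonneg (hℓ b) h0b.le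
    have t3 : 0 ≤ ℓ c * (prodBernoulli w).real (openConn s c : Set (BondConfig V)) := mul_nonneg (hℓ c) h0c.le
    have e1 : ℓ a * (prodBernoulli w).real (openConn s a : Set (BondConfig V)) = 0 := by linarith
    have e2 : ℓ b * (prodBernoulli w).real (openConn s b : Set (BondConfig V)) = 0 := by linarith
    have e3 : ℓ c * (prodBernoulli w).real (openConn s c : Set (BondConfig V)) = 0 := by linarith
    have x0 : ℓ a = 0 := by
      rcases mul_eq_zero.1 e1 with h | h
      · exact h
      · exact absurd h h0a.ne'
    have y0 : ℓ b = 0 := by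
      rcases mul_eq_zero.1 e2 with h | h
      · exact h
      · exact absurd h h0b.ne'
    have z0 : ℓ c = 0 := by
      rcases mul_eq_zero.1 e3 with h | h
      · exact h
      · exact absurd h h0c.ne'
    linarith [hpos, x0, y0, z0]
  set EL := ∫ ω, ∑ u, ℓ u * (openConn s u : Set (BondConfig V)).indicator 1 ω ∂(prodBernoulli w) with hEL'
  set EL2 := ∫ ω, (∑ u, ℓ u * (openConn s u : Set (BondConfig V)).indicator 1 ω) ^ 2 ∂(prodBernoulli w) with hEL2
  set EL3 := ∫ ω, (∑ u, ℓ u * (openConn s u : Set (BondConfig V)).indicator 1 ω) ^ 3 ∂(prodBernoulli w) with hEL3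
  set ES := ∫ ω, ∑ v, ∑ x, ℓ v * ℓ x * (openConn v x : Set (BondConfig V)).indicator 1 ω ∂(prodBernoulli w) with hES
  set ELS := ∫ ω, (∑ u, ℓ u * (openConn s u : Set (BondConfig V)).indicator 1 ω)
      * (∑ v, ∑ x, ℓ v * ℓ x * (openConn v x : Set (BondConfig V)).indicator 1 ω) ∂(prodBernoulli w) with hELS
  clear_value EL EL2 EL3 ES ELS
  have h3 : 3 * (EL2 - EL ^ 2) ^ 2 / EL ≤ 6 * (EL * (ES - EL2) - (ELS - EL3)) := by
    rw [div_le_iff₀ hEL]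
    nlinarith [hV]
  linarith [hP, h3]

end APL

end Summit.CriticalPhenomena.PercolationContinuityZ3.Theorems
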